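import Summits.AtomisticToContinuum.HydrodynamicLimit.Theses.JParityClosure
import Literature.MathematicalPhysics.KineticTheory.EvenCollisionTubeFunctional
import Literature.MathematicalPhysics.KineticTheory.KineticEntropyBalanceFunctional
import Literature.MathematicalPhysics.KineticTheory.EvenStatTruncationBound
import Literature.MathematicalPhysics.KineticTheory.HardSphereUniformDensityLLN
import Summits.AtomisticToContinuum.HydrodynamicLimit.Theorems.EnskogAdjointDualityDualityReductionMaxwellian
import HarnessLib

/-!
# Enskog identification (stub S6b of the line `stationary-microscale-hierarchy-entrance-law`,
# crux `JParityClosure.EvenStressEnskog`, stmt-AtomisticToContinuum-13079) — helper 2: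
# the mollified empirical fields and the local Maxwellian (sums, measurability, energy bounds)

For one configuration `z` of `N + 1` particles on `𝕋³`, the cone scale `r > 0` and a centre `x`:

* `measurable_mollDensity_comp`, `measurable_mollMomentum_comp`, `measurable_mollKineticEnergy_comp`,
  `measurable_mollTemperature_comp`, `measurable_uC_comp`, `measurable_localMaxwellian_one_comp` — Borel
  measurability of `ρ_r, m_r, e_r, θ_r, u_r = ρ_r⁻¹ m_r` composed with measurable maps, and of the local
  Maxwellian `M_{1,θ,u}(v)` jointly in `(θ, u, v)` (`Real.rpow` is Borel);
* `mollKineticEnergy_le` — `e_r(z,x) ≤ (3/πr³) E(z)/(N+1)`;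
  `avg_coneKernel_mul_norm_sub_sq_eq` / `avg_coneKernel_mul_norm_sub_uC_sq_le` — the peculiar second
  moment `(N+1)⁻¹ Σᵢ b_r(xᵢ,x) ‖vᵢ − u_r‖² = 2e_r − ‖m_r‖²/ρ_r ≤ 2 e_r` (junk branch `ρ_r = 0` included);
  `mollDensity_mul_mollTemperature_le` — `ρ_r θ_r ≤ (2/3) e_r`;
* `integral_localMaxwellian_mul_norm_sub_sq` (`∫ M_{1,θ,u} ‖v − u‖² = 3θ`),
  `abs_integral_mul_localMaxwellian_le` — for a kernel `|F(v,u,θ)| ≤ C ‖v − u‖²`,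
  `|∫ F(v,u,θ) M_{1,θ,u}(v) dv| ≤ 3 C max θ 0`; `measurable_integral_mul_localMaxwellian` — the pairing
  `(u, θ) ↦ ∫ F(v,u,θ) M_{1,θ,u}(v) dv` is Borel for continuous `F` (Fubini measurability).

The finite-sum form of `m_r` is read through `integral_empiricalMeasure_vec` (the named lemma
`mollMomentum_eq_sum` lives in the sibling S6a file `JParityClosureEvenStressEnskogEnskogPointwise.lean`, not
imported here to keep the two stub files independent; for the same reason the junk branch `θ ≤ 0 ⇒ M ≡ 0` is a
PRIVATE local copy).  The file ends with the registered Tools sub-stub `stub_enskogIdentificationFieldsTools`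
(conjunction of the three energy bounds).

References: H. Spohn, *Large Scale Dynamics of Interacting Particles* (1991), Part I §2.3, §3.2.
-/

noncomputable section

open scoped BigOperators InnerProductSpace Topology ENNReal
open MeasureTheory Filter Set
open Literature.MathematicalPhysics.KineticTheory Literature.Analysis.FluidPDE

namespace Summit.AtomisticToContinuum.HydrodynamicLimit.Theorems.EvenStressEnskog

variable {N : ℕ}

/-! ## Empirical sums -/

/-- Empirical average of a vector-valued observable: `∫ f dμ_z = (N+1)⁻¹ ∑ᵢ f(zᵢ)` (the tree's
`integral_empiricalMeasure` is the scalar case). [folklore] -/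
theorem integral_empiricalMeasure_vec (z : Config (N + 1) (Fin 3) T3) (f : T3 × V3 → V3) :
    ∫ q, f q ∂(empiricalMeasure z) = ((N + 1 : ℕ) : ℝ)⁻¹ • ∑ i, f (z i) := by
  rw [empiricalMeasure_eq, integral_smul_measure, integral_finsetSum_measure fun i _ => integrable_dirac (by simp)]
  have h : ((N : ℝ≥0∞) + 1).toReal = (N : ℝ) + 1 := by
    rw [← Nat.cast_succ, ENNReal.toReal_natCast, Nat.cast_succ]
  simp [integral_dirac, ENNReal.toReal_inv, h]

/-! ## Measurability of the mollified fields -/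

section Measurability

variable {α : Type*} [MeasurableSpace α] {f : α → Config (N + 1) (Fin 3) T3} {g : α → T3}

/-- `ρ_r` composed with measurable maps is measurable. [folklore] -/
theorem measurable_mollDensity_comp (r : ℝ) (hf : Measurable f) (hg : Measurable g) :
    Measurable fun a => mollDensity r (f a) (g a) := by
  have h : (fun a => mollDensity r (f a) (g a)) =
      fun a => ((N + 1 : ℕ) : ℝ)⁻¹ * ∑ i, coneKernel r ((f a) i).1 (g a) :=
    funext fun a => mollDensity_eq_avg r (f a) (g a)
  rw [h]
  exact measurable_const.mul (Finset.measurable_sum _ fun i _ =>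
    measurable_coneKernel_comp r ((measurable_pi_apply i).comp hf).fst hg)

/-- `m_r` composed with measurable maps is measurable. [folklore] -/
theorem measurable_mollMomentum_comp (r : ℝ) (hf : Measurable f) (hg : Measurable g) :
    Measurable fun a => mollMomentum r (f a) (g a) := by
  have h : (fun a => mollMomentum r (f a) (g a)) =
      fun a => ((N + 1 : ℕ) : ℝ)⁻¹ • ∑ i, coneKernel r ((f a) i).1 (g a) • ((f a) i).2 :=
    funext fun a => by unfold mollMomentum; rw [integral_empiricalMeasure_vec]
  rw [h]
  exact Measurable.const_smul (M := ℝ) (Finset.measurable_sum _ fun i _ =>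
    (measurable_coneKernel_comp r ((measurable_pi_apply i).comp hf).fst hg).smul
      ((measurable_pi_apply i).comp hf).snd) _

/-- `e_r` composed with measurable maps is measurable. [folklore] -/
theorem measurable_mollKineticEnergy_comp (r : ℝ) (hf : Measurable f) (hg : Measurable g) :
    Measurable fun a => mollKineticEnergy r (f a) (g a) := by
  have h : (fun a => mollKineticEnergy r (f a) (g a)) =
      fun a => ((N + 1 : ℕ) : ℝ)⁻¹ * ∑ i, coneKernel r ((f a) i).1 (g a) * (‖((f a) i).2‖ ^ 2 / 2) :=
    funext fun a => mollKineticEnergy_eq_sum r (f a) (g a)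
  rw [h]
  exact measurable_const.mul (Finset.measurable_sum _ fun i _ =>
    (measurable_coneKernel_comp r ((measurable_pi_apply i).comp hf).fst hg).mul
      ((((measurable_pi_apply i).comp hf).snd.norm.pow_const 2).div_const 2))

/-- `θ_r` composed with measurable maps is measurable. [folklore] -/
theorem measurable_mollTemperature_comp (r : ℝ) (hf : Measurable f) (hg : Measurable g) :
    Measurable fun a => mollTemperature r (f a) (g a) := by
  unfold mollTemperature
  have hρ := measurable_mollDensity_comp r hf hg
  have hm := measurable_mollMomentum_comp r hf hg
  have he := measurable_mollKineticEnergy_comp r hf hg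
  exact measurable_const.mul ((he.div hρ).sub ((hm.norm.pow_const 2).div ((hρ.pow_const 2).const_mul 2)))

/-- `u_r = ρ_r⁻¹ m_r` composed with measurable maps is measurable. [folklore] -/
theorem measurable_uC_comp (r : ℝ) (hf : Measurable f) (hg : Measurable g) :
    Measurable fun a => KineticEntropyBalance.uC r (f a) (g a) := by
  unfold KineticEntropyBalance.uC
  exact (measurable_mollDensity_comp r hf hg).inv.smul (measurable_mollMomentum_comp r hf hg)

/-- The local Maxwellian `M_{1,θ,u}(v)` is jointly Borel in `(θ, u, v)` (`Real.rpow`, `exp`, norms).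
[folklore] -/
theorem measurable_localMaxwellian_one_comp {θ : α → ℝ} {u v : α → V3} (hθ : Measurable θ)
    (hu : Measurable u) (hv : Measurable v) :
    Measurable fun a => localMaxwellian 1 (θ a) (u a) (v a) := by
  unfold localMaxwellian
  refine (measurable_const.mul ((hθ.const_mul _).pow_const _)).mul (Real.measurable_exp.comp ?_)
  exact (((hv.sub hu).norm.pow_const 2).neg).div (hθ.const_mul 2)

end Measurability

/-! ## Energy bounds of the mollified fields -/

/-- `e_r(z, x) ≤ (3/πr³) · E(z)/(N+1)`. [folklore] -/
theorem mollKineticEnergy_le {r : ℝ} (hr : 0 < r) (z : Config (N + 1) (Fin 3) T3) (x : T3) :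
    mollKineticEnergy r z x ≤ 3 / (Real.pi * r ^ 3) * (configEnergy z / ((N + 1 : ℕ) : ℝ)) := by
  rw [mollKineticEnergy_eq_sum]
  have hterm : ∀ i, coneKernel r (z i).1 x * (‖(z i).2‖ ^ 2 / 2) ≤
      3 / (Real.pi * r ^ 3) * (‖(z i).2‖ ^ 2 / 2) := fun i =>
    mul_le_mul_of_nonneg_right (coneKernel_mem_Icc hr _ _).2 (by positivity)
  calc ((N + 1 : ℕ) : ℝ)⁻¹ * ∑ i, coneKernel r (z i).1 x * (‖(z i).2‖ ^ 2 / 2)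
      ≤ ((N + 1 : ℕ) : ℝ)⁻¹ * ∑ i, 3 / (Real.pi * r ^ 3) * (‖(z i).2‖ ^ 2 / 2) :=
        mul_le_mul_of_nonneg_left (Finset.sum_le_sum fun i _ => hterm i) (by positivity)
    _ = 3 / (Real.pi * r ^ 3) * (configEnergy z / ((N + 1 : ℕ) : ℝ)) := by
        unfold configEnergy
        rw [← Finset.mul_sum, ← Finset.sum_div]
        ring

/-- `0 ≤ e_r` (`0 < r`). [folklore] -/
theorem mollKineticEnergy_nonneg {r : ℝ} (hr : 0 < r) (z : Config (N + 1) (Fin 3) T3) (x : T3) :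
    0 ≤ mollKineticEnergy r z x := by
  rw [mollKineticEnergy_eq_sum]
  exact mul_nonneg (inv_nonneg.2 (Nat.cast_nonneg _))
    (Finset.sum_nonneg fun i _ => mul_nonneg (coneKernel_mem_Icc hr _ _).1 (by positivity))

/-- **The peculiar second moment about an arbitrary velocity**:
`(N+1)⁻¹ Σᵢ b_r(xᵢ,x) ‖vᵢ − u‖² = 2e_r − 2⟪m_r, u⟫ + ρ_r ‖u‖²`. [folklore] -/
theorem avg_coneKernel_mul_norm_sub_sq_eq (r : ℝ) (z : Config (N + 1) (Fin 3) T3) (x : T3) (u : V3) :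
    ((N + 1 : ℕ) : ℝ)⁻¹ * ∑ i, coneKernel r (z i).1 x * ‖(z i).2 - u‖ ^ 2 =
      2 * mollKineticEnergy r z x - 2 * ⟪mollMomentum r z x, u⟫_ℝ + mollDensity r z x * ‖u‖ ^ 2 := by
  have hm : mollMomentum r z x = ((N + 1 : ℕ) : ℝ)⁻¹ • ∑ i, coneKernel r (z i).1 x • (z i).2 := by
    unfold mollMomentum; rw [integral_empiricalMeasure_vec]
  rw [mollKineticEnergy_eq_sum, hm, mollDensity_eq_avg, real_inner_smul_left, sum_inner]
  simp_rw [real_inner_smul_left, norm_sub_sq_real]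
  rw [show ∀ (c A B C : ℝ), 2 * (c * A) - 2 * (c * B) + c * C * ‖u‖ ^ 2 = c * (2 * A - 2 * B + C * ‖u‖ ^ 2)
    from fun c A B C => by ring]
  congr 1
  rw [Finset.mul_sum, Finset.mul_sum, Finset.sum_mul, ← Finset.sum_sub_distrib, ← Finset.sum_add_distrib]
  exact Finset.sum_congr rfl fun i _ => by ring

/-- **The peculiar second moment is at most twice the kinetic energy**:
`(N+1)⁻¹ Σᵢ b_r(xᵢ,x) ‖vᵢ − u_r‖² ≤ 2 e_r` (`= 2e_r − ‖m_r‖²/ρ_r` for `ρ_r > 0`; `= 2e_r` in the junk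
branch `ρ_r = 0`, where `u_r = 0`). [folklore] -/
theorem avg_coneKernel_mul_norm_sub_uC_sq_le {r : ℝ} (hr : 0 < r) (z : Config (N + 1) (Fin 3) T3)
    (x : T3) :
    ((N + 1 : ℕ) : ℝ)⁻¹ * ∑ i, coneKernel r (z i).1 x * ‖(z i).2 - KineticEntropyBalance.uC r z x‖ ^ 2 ≤
      2 * mollKineticEnergy r z x := by
  rw [avg_coneKernel_mul_norm_sub_sq_eq]
  unfold KineticEntropyBalance.uC
  set ρ := mollDensity r z x with hρdef
  set m := mollMomentum r z x with hmdef
  have hρ0 : 0 ≤ ρ := mollDensity_nonneg_of_pos hr z x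
  rw [real_inner_smul_right, real_inner_self_eq_norm_sq, norm_smul, Real.norm_eq_abs, abs_inv,
    abs_of_nonneg hρ0]
  rcases hρ0.eq_or_lt with h0 | hpos
  · rw [← h0]; simp
  · have : 2 * (ρ⁻¹ * ‖m‖ ^ 2) - ρ * (ρ⁻¹ * ‖m‖) ^ 2 = ρ⁻¹ * ‖m‖ ^ 2 := by
      field_simp
      ring
    nlinarith [mul_nonneg (inv_nonneg.2 hpos.le) (sq_nonneg ‖m‖)]

/-- **`ρ_r θ_r ≤ (2/3) e_r`** (for `ρ_r > 0`, `ρ_r θ_r = (2/3)(e_r − ‖m_r‖²/(2ρ_r))`; `0` in the junk branch).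
[folklore] -/
theorem mollDensity_mul_mollTemperature_le {r : ℝ} (hr : 0 < r) (z : Config (N + 1) (Fin 3) T3)
    (x : T3) : mollDensity r z x * mollTemperature r z x ≤ 2 / 3 * mollKineticEnergy r z x := by
  unfold mollTemperature
  set ρ := mollDensity r z x with hρdef
  set m := mollMomentum r z x with hmdef
  set e := mollKineticEnergy r z x with hedef
  have hρ0 : 0 ≤ ρ := mollDensity_nonneg_of_pos hr z x
  have he0 : 0 ≤ e := mollKineticEnergy_nonneg hr z x
  rcases hρ0.eq_or_lt with h0 | hpos
  · rw [← h0]; simp; positivity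
  · have : ρ * (2 / 3 * (e / ρ - ‖m‖ ^ 2 / (2 * ρ ^ 2))) = 2 / 3 * e - ‖m‖ ^ 2 / (3 * ρ) := by
      field_simp
    rw [this]
    linarith [div_nonneg (sq_nonneg ‖m‖) (by positivity : (0 : ℝ) ≤ 3 * ρ)]

/-! ## The local Maxwellian: junk branch, second moment, pairing with quadratic kernels -/

/-- For `θ ≤ 0` the local Maxwellian on `ℝ³` vanishes identically (`(2πθ)^{-3/2} = 0` for a negative
base since `cos(−3π/2) = 0`, and `0^{-3/2} = 0`).  PRIVATE local copy of the sibling S6a file's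
`localMaxwellian_eq_zero_of_nonpos` (not imported, see the module docstring). [folklore] -/
private theorem localMaxwellian_one_eq_zero_of_nonpos {θ : ℝ} (hθ : θ ≤ 0) (u v : V3) :
    localMaxwellian 1 θ u v = 0 := by
  unfold localMaxwellian
  have hfin : (Module.finrank ℝ V3 : ℝ) = 3 := by
    rw [finrank_euclideanSpace_fin]; norm_num
  have hexp : (-(Module.finrank ℝ V3 : ℝ) / 2 : ℝ) = -(3 / 2) := by rw [hfin]; norm_num
  rw [hexp]
  have hbase : (2 * Real.pi * θ) ^ (-(3 / 2 : ℝ)) = 0 := by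
    rcases hθ.eq_or_lt with rfl | hlt
    · rw [mul_zero, Real.zero_rpow (by norm_num)]
    · have hneg : 2 * Real.pi * θ < 0 := mul_neg_of_pos_of_neg (by positivity) hlt
      rw [Real.rpow_def_of_neg hneg]
      have hcos : Real.cos (-(3 / 2 : ℝ) * Real.pi) = 0 := by
        rw [show -(3 / 2 : ℝ) * Real.pi = -(Real.pi / 2 + Real.pi) by ring, Real.cos_neg,
          Real.cos_add_pi, Real.cos_pi_div_two, neg_zero]
      rw [hcos, mul_zero]
  rw [hbase, mul_zero, zero_mul]

/-- **Second moment of the local Maxwellian**: `∫ M_{1,θ,u}(v) ‖v − u‖² dv = 3θ` (`θ > 0`). [folklore] -/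
theorem integral_localMaxwellian_mul_norm_sub_sq {θ : ℝ} (hθ : 0 < θ) (u : V3) :
    ∫ v, localMaxwellian 1 θ u v * ‖v - u‖ ^ 2 = 3 * θ := by
  have h := integral_localMaxwellian_mul_affine hθ u (‖u‖ ^ 2) 2 ((-2 : ℝ) • u)
  have e : (fun v : V3 => localMaxwellian 1 θ u v * ‖v - u‖ ^ 2) =
      fun v => localMaxwellian 1 θ u v * (‖u‖ ^ 2 + ⟪(-2 : ℝ) • u, v⟫_ℝ + 2 * ‖v‖ ^ 2 / 2) := by
    funext v
    rw [norm_sub_sq_real, real_inner_smul_left, real_inner_comm]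
    ring
  rw [e, h, real_inner_smul_left, real_inner_self_eq_norm_sq]
  ring

/-- `v ↦ M_{1,θ,u}(v) ‖v − u‖²` is integrable (`θ > 0`). [folklore] -/
theorem integrable_localMaxwellian_mul_norm_sub_sq {θ : ℝ} (hθ : 0 < θ) (u : V3) :
    Integrable fun v => localMaxwellian 1 θ u v * ‖v - u‖ ^ 2 := by
  refine integrable_localMaxwellian_mul_of_abs_le hθ u (by fun_prop) (K := 2 + 2 * ‖u‖ ^ 2) fun v => ?_
  rw [abs_of_nonneg (sq_nonneg _)]
  have h1 : ‖v - u‖ ^ 2 ≤ 2 * ‖v‖ ^ 2 + 2 * ‖u‖ ^ 2 := by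
    have h' : ‖v - u‖ ^ 2 ≤ (‖v‖ + ‖u‖) ^ 2 := pow_le_pow_left₀ (norm_nonneg _) (norm_sub_le v u) 2
    nlinarith [sq_nonneg (‖v‖ - ‖u‖)]
  nlinarith [sq_nonneg ‖v‖, sq_nonneg ‖u‖, mul_nonneg (sq_nonneg ‖u‖) (sq_nonneg ‖v‖),
    sq_nonneg (‖v‖ ^ 2), mul_nonneg (sq_nonneg ‖u‖) (sq_nonneg (‖v‖ ^ 2))]

/-- **Pairing a quadratic kernel with the local Maxwellian.**  If `|F(v, u, θ)| ≤ C ‖v − u‖²` then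
`|∫ F(v, u, θ) M_{1,θ,u}(v) dv| ≤ 3 C max θ 0` (`= 3Cθ` by the second moment for `θ > 0`; both sides
vanish for `θ ≤ 0`, where `M ≡ 0`). [folklore] -/
theorem abs_integral_mul_localMaxwellian_le {F : V3 × V3 × ℝ → ℝ} {C : ℝ}
    (hFb : ∀ v u θ, |F (v, u, θ)| ≤ C * ‖v - u‖ ^ 2) (u : V3) (θ : ℝ) :
    |∫ v, F (v, u, θ) * localMaxwellian 1 θ u v| ≤ 3 * C * max θ 0 := by
  rcases le_or_gt θ 0 with hθ | hθ
  · simp [localMaxwellian_one_eq_zero_of_nonpos hθ, max_eq_right hθ]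
  · rw [max_eq_left hθ.le]
    have hint := (integrable_localMaxwellian_mul_norm_sub_sq hθ u).const_mul C
    have hle : ∀ᵐ v ∂(volume : Measure V3), ‖F (v, u, θ) * localMaxwellian 1 θ u v‖ ≤
        C * (localMaxwellian 1 θ u v * ‖v - u‖ ^ 2) := ae_of_all _ fun v => by
      have hM := localMaxwellian_nonneg zero_le_one hθ.le u v
      rw [Real.norm_eq_abs, abs_mul, abs_of_nonneg hM]
      calc |F (v, u, θ)| * localMaxwellian 1 θ u v ≤ C * ‖v - u‖ ^ 2 * localMaxwellian 1 θ u v :=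
            mul_le_mul_of_nonneg_right (hFb v u θ) hM
        _ = C * (localMaxwellian 1 θ u v * ‖v - u‖ ^ 2) := by ring
    have h := norm_integral_le_of_norm_le hint hle
    rw [Real.norm_eq_abs, integral_const_mul, integral_localMaxwellian_mul_norm_sub_sq hθ] at h
    linarith

/-- **The Maxwellian pairing is Borel in the parameters**: for continuous `F`,
`(u, θ) ↦ ∫ F(v, u, θ) M_{1,θ,u}(v) dv` is measurable (Fubini measurability of a jointly measurable
integrand). [folklore] -/
theorem measurable_integral_mul_localMaxwellian {F : V3 × V3 × ℝ → ℝ} (hF : Continuous F) :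
    Measurable fun p : V3 × ℝ => ∫ v, F (v, p.1, p.2) * localMaxwellian 1 p.2 p.1 v := by
  have hm : Measurable fun q : (V3 × ℝ) × V3 => F (q.2, q.1.1, q.1.2) * localMaxwellian 1 q.1.2 q.1.1 q.2 :=
    (hF.measurable.comp (measurable_snd.prodMk (measurable_fst.fst.prodMk measurable_fst.snd))).mul
      (measurable_localMaxwellian_one_comp measurable_fst.snd measurable_fst.fst measurable_snd)
  exact (hm.stronglyMeasurable.integral_prod_right' (ν := volume)).measurable


/-! ## Registered Tools sub-stub -/

/-- **Tools sub-stub of the Enskog identification (S6b), fields part** — registered on the crux item so that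
this helper file rides with `stub_enskogIdentification_of_pointwise`: the peculiar second moment is at most
`2e_r`, `ρ_rθ_r ≤ (2/3)e_r`, and the Maxwellian second moment is `3θ`. [folklore] -/
theorem stub_enskogIdentificationFieldsTools :
    (∀ (N : ℕ) (r : ℝ), 0 < r → ∀ (z : Config (N + 1) (Fin 3) T3) (x : T3),
      ((N + 1 : ℕ) : ℝ)⁻¹ * ∑ i, coneKernel r (z i).1 x * ‖(z i).2 - KineticEntropyBalance.uC r z x‖ ^ 2 ≤
        2 * mollKineticEnergy r z x) ∧
    (∀ (N : ℕ) (r : ℝ), 0 < r → ∀ (z : Config (N + 1) (Fin 3) T3) (x : T3),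
      mollDensity r z x * mollTemperature r z x ≤ 2 / 3 * mollKineticEnergy r z x) ∧
    (∀ (θ : ℝ), 0 < θ → ∀ u : V3, ∫ v, localMaxwellian 1 θ u v * ‖v - u‖ ^ 2 = 3 * θ) :=
  ⟨fun _N _r hr z x => avg_coneKernel_mul_norm_sub_uC_sq_le hr z x,
    fun _N _r hr z x => mollDensity_mul_mollTemperature_le hr z x,
    fun _θ hθ u => integral_localMaxwellian_mul_norm_sub_sq hθ u⟩

end Summit.AtomisticToContinuum.HydrodynamicLimit.Theorems.EvenStressEnskog

end
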